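import Summits.BirchSwinnertonDyer.Rank1Residual.GaloisImage.FrobeniusOrderWitness
import Summits.BirchSwinnertonDyer.Rank1Residual.GaloisImage.ThreeAdicFrobeniusWitness
import HarnessLib

/-!
# E-SIDE INSTANCES for the PASS-rank3 rows (FILE C): `ρ̄_{E,3}` onto (+ the `3`-adic tower on the
# potentially-good rows) from Frobenius point counts on the integer model — n1011-p14's
# `GaloisImage/VisThreeESideInstances<k>.lean` recipe token-for-token (team n1011, seat p17, row T-IDX27-BSDP)

HONEST FRAMING (cell `b2b-bsdres`, run/shared/lean/b2b/bsd-rank1-residual/, verbatim in every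
file): the goal of the cell is to DELETE the COMBINATION-SHAPED residual classes of the
Birch–Swinnerton-Dyer formula for ALL analytic-rank `≤ 1` elliptic curves over `ℚ` — "full BSD
formula for every rank `≤ 1` curve in class `C`" assembled STRICTLY from published theorems — so
that the rank-`≤ 1` remainder becomes exactly the CONSTRUCTION-SHAPED classes, which are TYPED
(missing-input `Prop`s), NOT attempted. This is not "finishing BSD". Team n1011 (N10/N11): research
route; per-curve KERNEL INSTANCES (point counts by `decide`, then the tree's Frobenius-witness
criteria); they close nothing by themselves; nothing booked; no mark / label moved. THEOREMS only;
no definition, no named fact, no `sorry`.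

## What

For each target curve `E` of r1's PASS-rank3 rows below (Cremona integral models from
`HOME/b2b-bsdres-n1011-p17/gen9/census/T-IDX27-PASSRANK3-INPUTS.md`; `50256c1` already has its
instances in `VisThreeESideInstances7.lean` and is not repeated): `card_frob_v<E>_<ℓ>` (point counts
mod two or three small good primes), `surj3_frob_v<E>` (`hasSurjectiveModNGaloisRep_of_intModel_of_irr_of_order`:
one Frobenius with irreducible characteristic polynomial mod `3`, one of order `3`; [Serre1972] §2.4
Prop. 15) and, on the potentially-GOOD rows, `towerSurj3u_frob_v<E>`
(`forall_hasSurjectiveModNGaloisRep_three_pow_of_intModel_of_frobenius`: a β-witness `ℓ ≡ 2, 5 (mod 9)`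
with `a_ℓ ≡ 3, 6 (mod 9)`; [SerreAbelianLadic1968] IV-23 Lemma 3). Consumers: the BSDp twins
`Additive/X4ThreeVisibleIdx27RowShapes<k>.lean`.

Curves in this file: `416448db1` (G-ss), `437904i1` (M), `437904j1` (G-ord), `449352l1` (G-ss), `456201b1` (G-ss), `469989i1` (G-ss), `493866d1` (G-ss).
-/

set_option autoImplicit false

open WeierstrassCurve
open Literature.NumberTheory.EllipticCurves Literature.NumberTheory.GaloisRepresentations
  Summit.BirchSwinnertonDyer.BirchSwinnertonDyer.Rank1Residual.IntModel

namespace Summit.BirchSwinnertonDyer.Rank1Residual.GaloisImage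

/-- `416448db1`: `#Ẽ(𝔽_5) = 2` for Cremona's model `[0, 0, 0, 2292, -85520]` (`5 ∤ Δ`; `a_5 = 4`). [folklore] -/
theorem card_frob_v416448db1_5 :
    Nat.card (((⟨0, 0, 0, 2292, -85520⟩ : WeierstrassCurve ℤ).map
      (Int.castRingHom (ZMod 5))).toAffine.Point) = 2 := by
  rw [@WeierstrassCurve.natCard_point_eq_one_add_card (ZMod 5) (@ZMod.instField 5 ⟨by norm_num⟩) _ _ _
    (by decide +kernel), @card_sol_eq_sum_euler (ZMod 5) (@ZMod.instField 5 ⟨by norm_num⟩) _ _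
    (by rw [ZMod.ringChar_zmod_n]; decide), ZMod.card]
  decide +kernel

/-- `416448db1`: `#Ẽ(𝔽_43) = 48` for Cremona's model `[0, 0, 0, 2292, -85520]` (`43 ∤ Δ`; `a_43 = -4`). [folklore] -/
theorem card_frob_v416448db1_43 :
    Nat.card (((⟨0, 0, 0, 2292, -85520⟩ : WeierstrassCurve ℤ).map
      (Int.castRingHom (ZMod 43))).toAffine.Point) = 48 := by
  rw [@WeierstrassCurve.natCard_point_eq_one_add_card (ZMod 43) (@ZMod.instField 43 ⟨by norm_num⟩) _ _ _
    (by decide +kernel), @card_sol_eq_sum_euler (ZMod 43) (@ZMod.instField 43 ⟨by norm_num⟩) _ _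
    (by rw [ZMod.ringChar_zmod_n]; decide), ZMod.card]
  decide +kernel

/-- `416448db1`: `#Ẽ(𝔽_29) = 36` for Cremona's model `[0, 0, 0, 2292, -85520]` (`29 ∤ Δ`; `a_29 = -6`). [folklore] -/
theorem card_frob_v416448db1_29 :
    Nat.card (((⟨0, 0, 0, 2292, -85520⟩ : WeierstrassCurve ℤ).map
      (Int.castRingHom (ZMod 29))).toAffine.Point) = 36 := by
  rw [@WeierstrassCurve.natCard_point_eq_one_add_card (ZMod 29) (@ZMod.instField 29 ⟨by norm_num⟩) _ _ _
    (by decide +kernel), @card_sol_eq_sum_euler (ZMod 29) (@ZMod.instField 29 ⟨by norm_num⟩) _ _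
    (by rw [ZMod.ringChar_zmod_n]; decide), ZMod.card]
  decide +kernel

/-- **`ρ̄_{E,3}` is onto for Cremona 416448db1** (X4 at `3`, additive potentially good (G-ss); PASS-rank3 row of r1's table) from two Frobenius witnesses read off the integer model: `ℓ₁ = 5` (`a = 4`, `X² − aX + 5` irreducible mod 3) and `ℓ₂ = 43` (`≡ 1 (mod 3)`, `a = -4 ≡ 2`, `#Ẽ(𝔽_43) = 48`, `9 ∤ 48`). [cite: Serre1972, §2.4 Prop. 15] -/
theorem surj3_frob_v416448db1 {W : WeierstrassCurve ℚ} [W.IsElliptic] [W.IsGloballyMinimal]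
    (hI : integralModelInt W = ⟨0, 0, 0, 2292, -85520⟩) : W.HasSurjectiveModNGaloisRep 3 :=
  @hasSurjectiveModNGaloisRep_of_intModel_of_irr_of_order W _ _ _ hI 3 ⟨by norm_num⟩ 5 43 ⟨by norm_num⟩
    ⟨by norm_num⟩ (by norm_num) (by norm_num) (by decide +kernel) (by decide +kernel) _ _
    card_frob_v416448db1_5 card_frob_v416448db1_43 (by decide) (by decide) (by decide) (by decide)

/-- **The `3`-adic tower for Cremona 416448db1, hypothesis-free**: surj(3) by `surj3_frob_v416448db1`, then the β-witness `ℓ = 29` (`≡ 2 (mod 9)`, `a_29 = -6 ≡ 3 (mod 9)`, `#Ẽ(𝔽_29) = 36`). [cite: SerreAbelianLadic1968, Ch. IV §3.4, Lemma 3 (IV-23)] -/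
theorem towerSurj3u_frob_v416448db1 {W : WeierstrassCurve ℚ} [W.IsElliptic] [W.IsGloballyMinimal]
    (hI : integralModelInt W = ⟨0, 0, 0, 2292, -85520⟩) (n : ℕ) : W.HasSurjectiveModNGaloisRep (3 ^ n : ℕ) :=
  @forall_hasSurjectiveModNGaloisRep_three_pow_of_intModel_of_frobenius W _ _ _ hI (surj3_frob_v416448db1 hI)
    29 ⟨by norm_num⟩ (by decide +kernel) _ card_frob_v416448db1_29 (by decide) (by decide) n

/-- `437904i1`: `#Ẽ(𝔽_5) = 8` for Cremona's model `[0, 0, 0, -6257451, 5938869850]` (`5 ∤ Δ`; `a_5 = -2`). [folklore] -/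
theorem card_frob_v437904i1_5 :
    Nat.card (((⟨0, 0, 0, -6257451, 5938869850⟩ : WeierstrassCurve ℤ).map
      (Int.castRingHom (ZMod 5))).toAffine.Point) = 8 := by
  rw [@WeierstrassCurve.natCard_point_eq_one_add_card (ZMod 5) (@ZMod.instField 5 ⟨by norm_num⟩) _ _ _
    (by decide +kernel), @card_sol_eq_sum_euler (ZMod 5) (@ZMod.instField 5 ⟨by norm_num⟩) _ _
    (by rw [ZMod.ringChar_zmod_n]; decide), ZMod.card]
  decide +kernel

/-- `437904i1`: `#Ẽ(𝔽_13) = 12` for Cremona's model `[0, 0, 0, -6257451, 5938869850]` (`13 ∤ Δ`; `a_13 = 2`). [folklore] -/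
theorem card_frob_v437904i1_13 :
    Nat.card (((⟨0, 0, 0, -6257451, 5938869850⟩ : WeierstrassCurve ℤ).map
      (Int.castRingHom (ZMod 13))).toAffine.Point) = 12 := by
  rw [@WeierstrassCurve.natCard_point_eq_one_add_card (ZMod 13) (@ZMod.instField 13 ⟨by norm_num⟩) _ _ _
    (by decide +kernel), @card_sol_eq_sum_euler (ZMod 13) (@ZMod.instField 13 ⟨by norm_num⟩) _ _
    (by rw [ZMod.ringChar_zmod_n]; decide), ZMod.card]
  decide +kernel

/-- **`ρ̄_{E,3}` is onto for Cremona 437904i1** (X4 at `3`, additive potentially multiplicative; PASS-rank3 row of r1's table) from two Frobenius witnesses read off the integer model: `ℓ₁ = 5` (`a = -2`, `X² − aX + 5` irreducible mod 3) and `ℓ₂ = 13` (`≡ 1 (mod 3)`, `a = 2 ≡ 2`, `#Ẽ(𝔽_13) = 12`, `9 ∤ 12`). [cite: Serre1972, §2.4 Prop. 15] -/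
theorem surj3_frob_v437904i1 {W : WeierstrassCurve ℚ} [W.IsElliptic] [W.IsGloballyMinimal]
    (hI : integralModelInt W = ⟨0, 0, 0, -6257451, 5938869850⟩) : W.HasSurjectiveModNGaloisRep 3 :=
  @hasSurjectiveModNGaloisRep_of_intModel_of_irr_of_order W _ _ _ hI 3 ⟨by norm_num⟩ 5 13 ⟨by norm_num⟩
    ⟨by norm_num⟩ (by norm_num) (by norm_num) (by decide +kernel) (by decide +kernel) _ _
    card_frob_v437904i1_5 card_frob_v437904i1_13 (by decide) (by decide) (by decide) (by decide)

/-- `437904j1`: `#Ẽ(𝔽_5) = 8` for Cremona's model `[0, 0, 0, -251931, -48671030]` (`5 ∤ Δ`; `a_5 = -2`). [folklore] -/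
theorem card_frob_v437904j1_5 :
    Nat.card (((⟨0, 0, 0, -251931, -48671030⟩ : WeierstrassCurve ℤ).map
      (Int.castRingHom (ZMod 5))).toAffine.Point) = 8 := by
  rw [@WeierstrassCurve.natCard_point_eq_one_add_card (ZMod 5) (@ZMod.instField 5 ⟨by norm_num⟩) _ _ _
    (by decide +kernel), @card_sol_eq_sum_euler (ZMod 5) (@ZMod.instField 5 ⟨by norm_num⟩) _ _
    (by rw [ZMod.ringChar_zmod_n]; decide), ZMod.card]
  decide +kernel

/-- `437904j1`: `#Ẽ(𝔽_31) = 24` for Cremona's model `[0, 0, 0, -251931, -48671030]` (`31 ∤ Δ`; `a_31 = 8`). [folklore] -/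
theorem card_frob_v437904j1_31 :
    Nat.card (((⟨0, 0, 0, -251931, -48671030⟩ : WeierstrassCurve ℤ).map
      (Int.castRingHom (ZMod 31))).toAffine.Point) = 24 := by
  rw [@WeierstrassCurve.natCard_point_eq_one_add_card (ZMod 31) (@ZMod.instField 31 ⟨by norm_num⟩) _ _ _
    (by decide +kernel), @card_sol_eq_sum_euler (ZMod 31) (@ZMod.instField 31 ⟨by norm_num⟩) _ _
    (by rw [ZMod.ringChar_zmod_n]; decide), ZMod.card]
  decide +kernel

/-- `437904j1`: `#Ẽ(𝔽_47) = 51` for Cremona's model `[0, 0, 0, -251931, -48671030]` (`47 ∤ Δ`; `a_47 = -3`). [folklore] -/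
theorem card_frob_v437904j1_47 :
    Nat.card (((⟨0, 0, 0, -251931, -48671030⟩ : WeierstrassCurve ℤ).map
      (Int.castRingHom (ZMod 47))).toAffine.Point) = 51 := by
  rw [@WeierstrassCurve.natCard_point_eq_one_add_card (ZMod 47) (@ZMod.instField 47 ⟨by norm_num⟩) _ _ _
    (by decide +kernel), @card_sol_eq_sum_euler (ZMod 47) (@ZMod.instField 47 ⟨by norm_num⟩) _ _
    (by rw [ZMod.ringChar_zmod_n]; decide), ZMod.card]
  decide +kernel

/-- **`ρ̄_{E,3}` is onto for Cremona 437904j1** (X4 at `3`, additive potentially good (G-ord); PASS-rank3 row of r1's table) from two Frobenius witnesses read off the integer model: `ℓ₁ = 5` (`a = -2`, `X² − aX + 5` irreducible mod 3) and `ℓ₂ = 31` (`≡ 1 (mod 3)`, `a = 8 ≡ 2`, `#Ẽ(𝔽_31) = 24`, `9 ∤ 24`). [cite: Serre1972, §2.4 Prop. 15] -/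
theorem surj3_frob_v437904j1 {W : WeierstrassCurve ℚ} [W.IsElliptic] [W.IsGloballyMinimal]
    (hI : integralModelInt W = ⟨0, 0, 0, -251931, -48671030⟩) : W.HasSurjectiveModNGaloisRep 3 :=
  @hasSurjectiveModNGaloisRep_of_intModel_of_irr_of_order W _ _ _ hI 3 ⟨by norm_num⟩ 5 31 ⟨by norm_num⟩
    ⟨by norm_num⟩ (by norm_num) (by norm_num) (by decide +kernel) (by decide +kernel) _ _
    card_frob_v437904j1_5 card_frob_v437904j1_31 (by decide) (by decide) (by decide) (by decide)

/-- **The `3`-adic tower for Cremona 437904j1, hypothesis-free**: surj(3) by `surj3_frob_v437904j1`, then the β-witness `ℓ = 47` (`≡ 2 (mod 9)`, `a_47 = -3 ≡ 6 (mod 9)`, `#Ẽ(𝔽_47) = 51`). [cite: SerreAbelianLadic1968, Ch. IV §3.4, Lemma 3 (IV-23)] -/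
theorem towerSurj3u_frob_v437904j1 {W : WeierstrassCurve ℚ} [W.IsElliptic] [W.IsGloballyMinimal]
    (hI : integralModelInt W = ⟨0, 0, 0, -251931, -48671030⟩) (n : ℕ) : W.HasSurjectiveModNGaloisRep (3 ^ n : ℕ) :=
  @forall_hasSurjectiveModNGaloisRep_three_pow_of_intModel_of_frobenius W _ _ _ hI (surj3_frob_v437904j1 hI)
    47 ⟨by norm_num⟩ (by decide +kernel) _ card_frob_v437904j1_47 (by decide) (by decide) n

/-- `449352l1`: `#Ẽ(𝔽_5) = 2` for Cremona's model `[0, 0, 0, -486798, -130655335]` (`5 ∤ Δ`; `a_5 = 4`). [folklore] -/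
theorem card_frob_v449352l1_5 :
    Nat.card (((⟨0, 0, 0, -486798, -130655335⟩ : WeierstrassCurve ℤ).map
      (Int.castRingHom (ZMod 5))).toAffine.Point) = 2 := by
  rw [@WeierstrassCurve.natCard_point_eq_one_add_card (ZMod 5) (@ZMod.instField 5 ⟨by norm_num⟩) _ _ _
    (by decide +kernel), @card_sol_eq_sum_euler (ZMod 5) (@ZMod.instField 5 ⟨by norm_num⟩) _ _
    (by rw [ZMod.ringChar_zmod_n]; decide), ZMod.card]
  decide +kernel

/-- `449352l1`: `#Ẽ(𝔽_7) = 12` for Cremona's model `[0, 0, 0, -486798, -130655335]` (`7 ∤ Δ`; `a_7 = -4`). [folklore] -/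
theorem card_frob_v449352l1_7 :
    Nat.card (((⟨0, 0, 0, -486798, -130655335⟩ : WeierstrassCurve ℤ).map
      (Int.castRingHom (ZMod 7))).toAffine.Point) = 12 := by
  rw [@WeierstrassCurve.natCard_point_eq_one_add_card (ZMod 7) (@ZMod.instField 7 ⟨by norm_num⟩) _ _ _
    (by decide +kernel), @card_sol_eq_sum_euler (ZMod 7) (@ZMod.instField 7 ⟨by norm_num⟩) _ _
    (by rw [ZMod.ringChar_zmod_n]; decide), ZMod.card]
  decide +kernel

/-- `449352l1`: `#Ẽ(𝔽_23) = 30` for Cremona's model `[0, 0, 0, -486798, -130655335]` (`23 ∤ Δ`; `a_23 = -6`). [folklore] -/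
theorem card_frob_v449352l1_23 :
    Nat.card (((⟨0, 0, 0, -486798, -130655335⟩ : WeierstrassCurve ℤ).map
      (Int.castRingHom (ZMod 23))).toAffine.Point) = 30 := by
  rw [@WeierstrassCurve.natCard_point_eq_one_add_card (ZMod 23) (@ZMod.instField 23 ⟨by norm_num⟩) _ _ _
    (by decide +kernel), @card_sol_eq_sum_euler (ZMod 23) (@ZMod.instField 23 ⟨by norm_num⟩) _ _
    (by rw [ZMod.ringChar_zmod_n]; decide), ZMod.card]
  decide +kernel

/-- **`ρ̄_{E,3}` is onto for Cremona 449352l1** (X4 at `3`, additive potentially good (G-ss); PASS-rank3 row of r1's table) from two Frobenius witnesses read off the integer model: `ℓ₁ = 5` (`a = 4`, `X² − aX + 5` irreducible mod 3) and `ℓ₂ = 7` (`≡ 1 (mod 3)`, `a = -4 ≡ 2`, `#Ẽ(𝔽_7) = 12`, `9 ∤ 12`). [cite: Serre1972, §2.4 Prop. 15] -/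
theorem surj3_frob_v449352l1 {W : WeierstrassCurve ℚ} [W.IsElliptic] [W.IsGloballyMinimal]
    (hI : integralModelInt W = ⟨0, 0, 0, -486798, -130655335⟩) : W.HasSurjectiveModNGaloisRep 3 :=
  @hasSurjectiveModNGaloisRep_of_intModel_of_irr_of_order W _ _ _ hI 3 ⟨by norm_num⟩ 5 7 ⟨by norm_num⟩
    ⟨by norm_num⟩ (by norm_num) (by norm_num) (by decide +kernel) (by decide +kernel) _ _
    card_frob_v449352l1_5 card_frob_v449352l1_7 (by decide) (by decide) (by decide) (by decide)

/-- **The `3`-adic tower for Cremona 449352l1, hypothesis-free**: surj(3) by `surj3_frob_v449352l1`, then the β-witness `ℓ = 23` (`≡ 5 (mod 9)`, `a_23 = -6 ≡ 3 (mod 9)`, `#Ẽ(𝔽_23) = 30`). [cite: SerreAbelianLadic1968, Ch. IV §3.4, Lemma 3 (IV-23)] -/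
theorem towerSurj3u_frob_v449352l1 {W : WeierstrassCurve ℚ} [W.IsElliptic] [W.IsGloballyMinimal]
    (hI : integralModelInt W = ⟨0, 0, 0, -486798, -130655335⟩) (n : ℕ) : W.HasSurjectiveModNGaloisRep (3 ^ n : ℕ) :=
  @forall_hasSurjectiveModNGaloisRep_three_pow_of_intModel_of_frobenius W _ _ _ hI (surj3_frob_v449352l1 hI)
    23 ⟨by norm_num⟩ (by decide +kernel) _ card_frob_v449352l1_23 (by decide) (by decide) n

/-- `456201b1`: `#Ẽ(𝔽_5) = 4` for Cremona's model `[1, -1, 0, -9501, -354088]` (`5 ∤ Δ`; `a_5 = 2`). [folklore] -/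
theorem card_frob_v456201b1_5 :
    Nat.card (((⟨1, -1, 0, -9501, -354088⟩ : WeierstrassCurve ℤ).map
      (Int.castRingHom (ZMod 5))).toAffine.Point) = 4 := by
  rw [@WeierstrassCurve.natCard_point_eq_one_add_card (ZMod 5) (@ZMod.instField 5 ⟨by norm_num⟩) _ _ _
    (by decide +kernel), @card_sol_eq_sum_euler (ZMod 5) (@ZMod.instField 5 ⟨by norm_num⟩) _ _
    (by rw [ZMod.ringChar_zmod_n]; decide), ZMod.card]
  decide +kernel

/-- `456201b1`: `#Ẽ(𝔽_7) = 12` for Cremona's model `[1, -1, 0, -9501, -354088]` (`7 ∤ Δ`; `a_7 = -4`). [folklore] -/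
theorem card_frob_v456201b1_7 :
    Nat.card (((⟨1, -1, 0, -9501, -354088⟩ : WeierstrassCurve ℤ).map
      (Int.castRingHom (ZMod 7))).toAffine.Point) = 12 := by
  rw [@WeierstrassCurve.natCard_point_eq_one_add_card (ZMod 7) (@ZMod.instField 7 ⟨by norm_num⟩) _ _ _
    (by decide +kernel), @card_sol_eq_sum_euler (ZMod 7) (@ZMod.instField 7 ⟨by norm_num⟩) _ _
    (by rw [ZMod.ringChar_zmod_n]; decide), ZMod.card]
  decide +kernel

/-- `456201b1`: `#Ẽ(𝔽_29) = 24` for Cremona's model `[1, -1, 0, -9501, -354088]` (`29 ∤ Δ`; `a_29 = 6`). [folklore] -/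
theorem card_frob_v456201b1_29 :
    Nat.card (((⟨1, -1, 0, -9501, -354088⟩ : WeierstrassCurve ℤ).map
      (Int.castRingHom (ZMod 29))).toAffine.Point) = 24 := by
  rw [@WeierstrassCurve.natCard_point_eq_one_add_card (ZMod 29) (@ZMod.instField 29 ⟨by norm_num⟩) _ _ _
    (by decide +kernel), @card_sol_eq_sum_euler (ZMod 29) (@ZMod.instField 29 ⟨by norm_num⟩) _ _
    (by rw [ZMod.ringChar_zmod_n]; decide), ZMod.card]
  decide +kernel

/-- **`ρ̄_{E,3}` is onto for Cremona 456201b1** (X4 at `3`, additive potentially good (G-ss); PASS-rank3 row of r1's table) from two Frobenius witnesses read off the integer model: `ℓ₁ = 5` (`a = 2`, `X² − aX + 5` irreducible mod 3) and `ℓ₂ = 7` (`≡ 1 (mod 3)`, `a = -4 ≡ 2`, `#Ẽ(𝔽_7) = 12`, `9 ∤ 12`). [cite: Serre1972, §2.4 Prop. 15] -/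
theorem surj3_frob_v456201b1 {W : WeierstrassCurve ℚ} [W.IsElliptic] [W.IsGloballyMinimal]
    (hI : integralModelInt W = ⟨1, -1, 0, -9501, -354088⟩) : W.HasSurjectiveModNGaloisRep 3 :=
  @hasSurjectiveModNGaloisRep_of_intModel_of_irr_of_order W _ _ _ hI 3 ⟨by norm_num⟩ 5 7 ⟨by norm_num⟩
    ⟨by norm_num⟩ (by norm_num) (by norm_num) (by decide +kernel) (by decide +kernel) _ _
    card_frob_v456201b1_5 card_frob_v456201b1_7 (by decide) (by decide) (by decide) (by decide)

/-- **The `3`-adic tower for Cremona 456201b1, hypothesis-free**: surj(3) by `surj3_frob_v456201b1`, then the β-witness `ℓ = 29` (`≡ 2 (mod 9)`, `a_29 = 6 ≡ 6 (mod 9)`, `#Ẽ(𝔽_29) = 24`). [cite: SerreAbelianLadic1968, Ch. IV §3.4, Lemma 3 (IV-23)] -/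
theorem towerSurj3u_frob_v456201b1 {W : WeierstrassCurve ℚ} [W.IsElliptic] [W.IsGloballyMinimal]
    (hI : integralModelInt W = ⟨1, -1, 0, -9501, -354088⟩) (n : ℕ) : W.HasSurjectiveModNGaloisRep (3 ^ n : ℕ) :=
  @forall_hasSurjectiveModNGaloisRep_three_pow_of_intModel_of_frobenius W _ _ _ hI (surj3_frob_v456201b1 hI)
    29 ⟨by norm_num⟩ (by decide +kernel) _ card_frob_v456201b1_29 (by decide) (by decide) n

/-- `469989i1`: `#Ẽ(𝔽_5) = 4` for Cremona's model `[1, -1, 1, 4531, -184102]` (`5 ∤ Δ`; `a_5 = 2`). [folklore] -/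
theorem card_frob_v469989i1_5 :
    Nat.card (((⟨1, -1, 1, 4531, -184102⟩ : WeierstrassCurve ℤ).map
      (Int.castRingHom (ZMod 5))).toAffine.Point) = 4 := by
  rw [@WeierstrassCurve.natCard_point_eq_one_add_card (ZMod 5) (@ZMod.instField 5 ⟨by norm_num⟩) _ _ _
    (by decide +kernel), @card_sol_eq_sum_euler (ZMod 5) (@ZMod.instField 5 ⟨by norm_num⟩) _ _
    (by rw [ZMod.ringChar_zmod_n]; decide), ZMod.card]
  decide +kernel

/-- `469989i1`: `#Ẽ(𝔽_7) = 6` for Cremona's model `[1, -1, 1, 4531, -184102]` (`7 ∤ Δ`; `a_7 = 2`). [folklore] -/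
theorem card_frob_v469989i1_7 :
    Nat.card (((⟨1, -1, 1, 4531, -184102⟩ : WeierstrassCurve ℤ).map
      (Int.castRingHom (ZMod 7))).toAffine.Point) = 6 := by
  rw [@WeierstrassCurve.natCard_point_eq_one_add_card (ZMod 7) (@ZMod.instField 7 ⟨by norm_num⟩) _ _ _
    (by decide +kernel), @card_sol_eq_sum_euler (ZMod 7) (@ZMod.instField 7 ⟨by norm_num⟩) _ _
    (by rw [ZMod.ringChar_zmod_n]; decide), ZMod.card]
  decide +kernel

/-- `469989i1`: `#Ẽ(𝔽_59) = 48` for Cremona's model `[1, -1, 1, 4531, -184102]` (`59 ∤ Δ`; `a_59 = 12`). [folklore] -/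
theorem card_frob_v469989i1_59 :
    Nat.card (((⟨1, -1, 1, 4531, -184102⟩ : WeierstrassCurve ℤ).map
      (Int.castRingHom (ZMod 59))).toAffine.Point) = 48 := by
  rw [@WeierstrassCurve.natCard_point_eq_one_add_card (ZMod 59) (@ZMod.instField 59 ⟨by norm_num⟩) _ _ _
    (by decide +kernel), @card_sol_eq_sum_euler (ZMod 59) (@ZMod.instField 59 ⟨by norm_num⟩) _ _
    (by rw [ZMod.ringChar_zmod_n]; decide), ZMod.card]
  decide +kernel

/-- **`ρ̄_{E,3}` is onto for Cremona 469989i1** (X4 at `3`, additive potentially good (G-ss); PASS-rank3 row of r1's table) from two Frobenius witnesses read off the integer model: `ℓ₁ = 5` (`a = 2`, `X² − aX + 5` irreducible mod 3) and `ℓ₂ = 7` (`≡ 1 (mod 3)`, `a = 2 ≡ 2`, `#Ẽ(𝔽_7) = 6`, `9 ∤ 6`). [cite: Serre1972, §2.4 Prop. 15] -/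
theorem surj3_frob_v469989i1 {W : WeierstrassCurve ℚ} [W.IsElliptic] [W.IsGloballyMinimal]
    (hI : integralModelInt W = ⟨1, -1, 1, 4531, -184102⟩) : W.HasSurjectiveModNGaloisRep 3 :=
  @hasSurjectiveModNGaloisRep_of_intModel_of_irr_of_order W _ _ _ hI 3 ⟨by norm_num⟩ 5 7 ⟨by norm_num⟩
    ⟨by norm_num⟩ (by norm_num) (by norm_num) (by decide +kernel) (by decide +kernel) _ _
    card_frob_v469989i1_5 card_frob_v469989i1_7 (by decide) (by decide) (by decide) (by decide)

/-- **The `3`-adic tower for Cremona 469989i1, hypothesis-free**: surj(3) by `surj3_frob_v469989i1`, then the β-witness `ℓ = 59` (`≡ 5 (mod 9)`, `a_59 = 12 ≡ 3 (mod 9)`, `#Ẽ(𝔽_59) = 48`). [cite: SerreAbelianLadic1968, Ch. IV §3.4, Lemma 3 (IV-23)] -/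
theorem towerSurj3u_frob_v469989i1 {W : WeierstrassCurve ℚ} [W.IsElliptic] [W.IsGloballyMinimal]
    (hI : integralModelInt W = ⟨1, -1, 1, 4531, -184102⟩) (n : ℕ) : W.HasSurjectiveModNGaloisRep (3 ^ n : ℕ) :=
  @forall_hasSurjectiveModNGaloisRep_three_pow_of_intModel_of_frobenius W _ _ _ hI (surj3_frob_v469989i1 hI)
    59 ⟨by norm_num⟩ (by decide +kernel) _ card_frob_v469989i1_59 (by decide) (by decide) n

/-- `493866d1`: `#Ẽ(𝔽_5) = 5` for Cremona's model `[1, -1, 1, -1262, -16937]` (`5 ∤ Δ`; `a_5 = 1`). [folklore] -/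
theorem card_frob_v493866d1_5 :
    Nat.card (((⟨1, -1, 1, -1262, -16937⟩ : WeierstrassCurve ℤ).map
      (Int.castRingHom (ZMod 5))).toAffine.Point) = 5 := by
  rw [@WeierstrassCurve.natCard_point_eq_one_add_card (ZMod 5) (@ZMod.instField 5 ⟨by norm_num⟩) _ _ _
    (by decide +kernel), @card_sol_eq_sum_euler (ZMod 5) (@ZMod.instField 5 ⟨by norm_num⟩) _ _
    (by rw [ZMod.ringChar_zmod_n]; decide), ZMod.card]
  decide +kernel

/-- `493866d1`: `#Ẽ(𝔽_19) = 24` for Cremona's model `[1, -1, 1, -1262, -16937]` (`19 ∤ Δ`; `a_19 = -4`). [folklore] -/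
theorem card_frob_v493866d1_19 :
    Nat.card (((⟨1, -1, 1, -1262, -16937⟩ : WeierstrassCurve ℤ).map
      (Int.castRingHom (ZMod 19))).toAffine.Point) = 24 := by
  rw [@WeierstrassCurve.natCard_point_eq_one_add_card (ZMod 19) (@ZMod.instField 19 ⟨by norm_num⟩) _ _ _
    (by decide +kernel), @card_sol_eq_sum_euler (ZMod 19) (@ZMod.instField 19 ⟨by norm_num⟩) _ _
    (by rw [ZMod.ringChar_zmod_n]; decide), ZMod.card]
  decide +kernel

/-- `493866d1`: `#Ẽ(𝔽_11) = 9` for Cremona's model `[1, -1, 1, -1262, -16937]` (`11 ∤ Δ`; `a_11 = 3`). [folklore] -/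
theorem card_frob_v493866d1_11 :
    Nat.card (((⟨1, -1, 1, -1262, -16937⟩ : WeierstrassCurve ℤ).map
      (Int.castRingHom (ZMod 11))).toAffine.Point) = 9 := by
  rw [@WeierstrassCurve.natCard_point_eq_one_add_card (ZMod 11) (@ZMod.instField 11 ⟨by norm_num⟩) _ _ _
    (by decide +kernel), @card_sol_eq_sum_euler (ZMod 11) (@ZMod.instField 11 ⟨by norm_num⟩) _ _
    (by rw [ZMod.ringChar_zmod_n]; decide), ZMod.card]
  decide +kernel

/-- **`ρ̄_{E,3}` is onto for Cremona 493866d1** (X4 at `3`, additive potentially good (G-ss); PASS-rank3 row of r1's table) from two Frobenius witnesses read off the integer model: `ℓ₁ = 5` (`a = 1`, `X² − aX + 5` irreducible mod 3) and `ℓ₂ = 19` (`≡ 1 (mod 3)`, `a = -4 ≡ 2`, `#Ẽ(𝔽_19) = 24`, `9 ∤ 24`). [cite: Serre1972, §2.4 Prop. 15] -/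
theorem surj3_frob_v493866d1 {W : WeierstrassCurve ℚ} [W.IsElliptic] [W.IsGloballyMinimal]
    (hI : integralModelInt W = ⟨1, -1, 1, -1262, -16937⟩) : W.HasSurjectiveModNGaloisRep 3 :=
  @hasSurjectiveModNGaloisRep_of_intModel_of_irr_of_order W _ _ _ hI 3 ⟨by norm_num⟩ 5 19 ⟨by norm_num⟩
    ⟨by norm_num⟩ (by norm_num) (by norm_num) (by decide +kernel) (by decide +kernel) _ _
    card_frob_v493866d1_5 card_frob_v493866d1_19 (by decide) (by decide) (by decide) (by decide)

/-- **The `3`-adic tower for Cremona 493866d1, hypothesis-free**: surj(3) by `surj3_frob_v493866d1`, then the β-witness `ℓ = 11` (`≡ 2 (mod 9)`, `a_11 = 3 ≡ 3 (mod 9)`, `#Ẽ(𝔽_11) = 9`). [cite: SerreAbelianLadic1968, Ch. IV §3.4, Lemma 3 (IV-23)] -/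
theorem towerSurj3u_frob_v493866d1 {W : WeierstrassCurve ℚ} [W.IsElliptic] [W.IsGloballyMinimal]
    (hI : integralModelInt W = ⟨1, -1, 1, -1262, -16937⟩) (n : ℕ) : W.HasSurjectiveModNGaloisRep (3 ^ n : ℕ) :=
  @forall_hasSurjectiveModNGaloisRep_three_pow_of_intModel_of_frobenius W _ _ _ hI (surj3_frob_v493866d1 hI)
    11 ⟨by norm_num⟩ (by decide +kernel) _ card_frob_v493866d1_11 (by decide) (by decide) n

end Summit.BirchSwinnertonDyer.Rank1Residual.GaloisImage
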